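/-
Copyright (c) 2026 the pub-hodgecm-mathlib formalisation cell (harness21).  Prover seat hodgecm-mathlib-K2Liu-p14 (g2), Track B «K2-LIT»,
#184♮ = hLiu418 = `stmt-HodgeConjecture-24832`; #42S organ S2, S2-W part 2 = (r-b) (LEAD F0P6-plan (g14) M-158f §4 S2-W, BATCH #20 (2), #22 (1);
K2Liu-p05 (g5) ★ J2c `K2LiuArchWeilJunctionTransport` + 13:27:07Z sub-input (a) by name; template ★ `K2LiuSwSectionArchOrbitDeriv.hasDerivAt_swSection_tmul_placeSecJ_expMem`).
-/
import Summits.HodgeConjecture.HodgeConjecture.Theorems.K2LiuArchSWValueFockDerivative       -- ★ (r-b) p860654 (same letters; this file hoists the Fock witness)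
import HarnessLib

/-!
# Crux `HLiu418`, organ S2, file S2-W (part 2′ = (r-b) UNIFORM): THE DERIVATIVE OF THE SIEGEL–WEIL SECTION OF `𝔻 ⊗ V′` ALONG A ONE-PLACE `U(2,2)` OF THE SMALL GROUP,
# ON POLYNOMIAL × GAUSSIAN DATA, IS AGAIN A SIEGEL–WEIL VALUE OF POLYNOMIAL × GAUSSIAN DATA — `d∕ds|₀ SW(Φ)(H·ψ(exp sY)) = SW(Φ_Y)(H)`, `Φ = 𝒥⁻¹((e_* B⁻¹F) ⊠ Φ₂)`,
# `Φ_Y = 𝒥⁻¹((e_* B⁻¹F_Y) ⊠ Φ₂)`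

Cell `hodgecm-mathlib`, crux item hLiu418 = `stmt-HodgeConjecture-24832`; squad K2 ∕ K2Liu; prover K2Liu-p14 (g2).  THEOREMS ONLY (no `def`, no instance declared, no
notation, no named-fact hypothesis, no `sorry`); the Mathlib idiom `attribute [local instance] LieRing.ofAssociativeRing` names `𝔲(2,2)` as in ★ (G2-W2)∕★ J2-lineage;
lane `--supports stmt-HodgeConjecture-24832 --as helper`.

SETTING = ★ J2c verbatim with the small place group literally `U(2,2)` (`P = Q = Fin 2`; FILE 3 relabels the sign types of `x_{𝔻,σ}` along ★ J0), partner `U(R,S)`,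
`ψ : U(2,2) →* H(L⁺ ⊗ ℝ)` with the (J2⊗-arch) identity `hsec` BY VALUE (K2E5-p16 (g6) FILE 2b), big datum `sB` of `𝔻 ⊗ V′`, `H ∈ H(𝔸)`, finite vector `f`.
THE THEOREM **`exists_fockPoly_hasDerivAt_swSectionTensor_oneplace_uniform`** (K2Liu-ref1 (g5) 13:34:55Z quantifier flag on ★ (r-b) p860654; LEAD BATCH #24 (a)):
for `Y ∈ 𝔲(2,2)`, a Fock polynomial `F` and `Φ₂` there is a Fock polynomial `F_Y` — chosen from `Y, F` ALONE — such that for EVERY point `H`, every `a` with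
`𝒥 a = (e_* B⁻¹F) ⊠ Φ₂` and every `a_Y` with `𝒥 a_Y = (e_* B⁻¹F_Y) ⊠ Φ₂`:
`HasDerivAt (s ↦ swSectionTensor sB (E(a ⊗ f)) (H · ψ(exp sY))) (swSectionTensor sB (E(a_Y ⊗ f)) H) 0`.
MECHANISM (★ :189 re-run on ★ J2c): by J2c, along the curve the section is `η(s) · ℓ′((e_* (ω(exp sY, 1) B⁻¹F)) ⊠ Φ₂)` with `ω = weilRepPair` the hypothesis-free junction
datum of `U(2,2) × U(R,S)`; the character leg `η(s) = η_t(placeSecJ_𝕎 σ (toBig(exp sY,1), 1))` is smooth (É. Cartan ★ `contDiffAt_character_inl` at the continuous character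
★ `continuous_coe_etaD_placeSecJ` ∘ ★ `continuous_toBig` — K2Liu-p05 (g5) 13:27:07Z); the Weil leg by ★ :132 `hasDerivAt_weilDatum_expMem_smul'` at the CLM
`ℓ′ ∘ (· ⊠ Φ₂) ∘ e_*`; product rule; `η′(0)·B⁻¹F + dω_Y(B⁻¹F) = B⁻¹(η′(0)F + G)` by ★ `exists_dOmega_binvPi`; the value is read back through J2c at `h = 1`.
References: [KudlaRallis1994, §1]; [Folland1989, §4.2 (4.24), Prop. (4.39)]; [Varadarajan1984, Thm. 2.10.1, 2.11.2]; [KonnoKonno2007, §3.3, Lemma 5.2];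
[Howe1989, §3 (polynomial × Gaussian is `(𝔤,K)`-stable)].
HONEST LABEL.  Count-neutral helper: `HC_CM` is proved only modulo the 7 printed citations (2 remaining named inputs: hLiu418 = `stmt-HodgeConjecture-24832`,
h413 = `stmt-HodgeConjecture-24833`) until rung 0 closes.
-/

set_option autoImplicit false
set_option linter.dupNamespace false -- the mandated namespace repeats `HodgeConjecture.HodgeConjecture`

noncomputable section

open scoped Classical Matrix TensorProduct Kronecker SchwartzMap MatrixGroups
open NumberField NumberField.InfinitePlace NumberField.mixedEmbedding IsDedekindDomain
open Literature.Analysis.SegalBargmann Literature.Analysis.Distribution Literature.RepresentationTheory.HeisenbergGroup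
open Literature.NumberTheory.Automorphic Literature.NumberTheory.Automorphic.UnitaryGroup Literature.NumberTheory.GaloisRepresentations
open Literature.NumberTheory.Weil1964 Literature.NumberTheory.Weil1964.MpS Literature.NumberTheory.Weil1964.UnitaryWeil
open Literature.RepresentationTheory.HarrisKudlaSweet1996
open Literature.RepresentationTheory.KonnoKonno2007 hiding LetterKind letterOf letterGen letterOf_boost letterOf_torus letterOf_torus_eq
  letterGen_boost letterGen_torus letterGen_mem_lie exp_smul_letterGen
open Literature.RepresentationTheory.KonnoKonno2007.RealDualPair
open Literature.NumberTheory.GelbartRogawski1991 Literature.NumberTheory.GelbartRogawski1991.GRConstruction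
open Literature.NumberTheory.GelbartRogawski1991.UnitaryDualPair
open Literature.NumberTheory.GelbartRogawski1991.UnitaryDualPair.LocalSplitting
open Literature.NumberTheory.K2Lit.SiegelDoubled
open Summit.HodgeConjecture.HodgeConjecture.Cruxes.HLiu418.K2LiuArchSectionPlaceBlock
open Summit.HodgeConjecture.HodgeConjecture.Cruxes.HLiu418 (K2LiuArchOneParameterOrbitDefs.archEmb)
open Summit.HodgeConjecture.HodgeConjecture.Cruxes.HLiu418.K2LiuSwSectionArchOrbit
open Summit.HodgeConjecture.HodgeConjecture.Cruxes.HLiu418.K2LiuWeilSeesawRelabel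
open Summit.HodgeConjecture.HodgeConjecture.Cruxes.HLiu418.K2LiuArchWeilJunctionTransport
open Summit.HodgeConjecture.HodgeConjecture.Cruxes.HLiu418.K2LiuU22AdaptedBasis
open Summit.HodgeConjecture.HodgeConjecture.Cruxes.HLiu418.K2LiuWeilDatumSmoothU22 (hasDerivAt_weilDatum_expMem_smul' contDiffAt_character_inl)
open Summit.HodgeConjecture.HodgeConjecture.Cruxes.HLiu418.K2LiuArchWeilFockDerivatives (exists_dOmega_binvPi)

-- Mathlib idiom (`Mathlib/Algebra/Lie/OfAssociative.lean`), as in ★ (G2-W2) ∕ ★ `K2LiuSwSectionArchOrbitDeriv`: the commutator bracket naming `𝔲(2,2)`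
attribute [local instance 100] LieRing.ofAssociativeRing

namespace Summit.HodgeConjecture.HodgeConjecture.Cruxes.HLiu418.K2LiuArchSWValueFockDerivativeUniform

variable (L : Type) [Field L] [NumberField L] [IsCMField L]
variable {N M n : ℕ} (e : Fin N × Fin M ≃ Fin n)
  (dV : Fin N → L) (hdV : ∀ i, IsCMField.complexConj L (dV i) = dV i) (hdV0 : ∀ i, dV i ≠ 0)
  (dW : Fin M → L) (hdW : ∀ i, IsCMField.complexConj L (dW i) = dW i) (hdW0 : ∀ i, dW i ≠ 0)
variable {M₂ M' n' : ℕ} (eW : Fin M × Fin M₂ ≃ Fin M') (e' : Fin N × Fin M' ≃ Fin n')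
  (dV' : Fin M₂ → L) (hdV' : ∀ k, IsCMField.complexConj L (dV' k) = dV' k) (hdV'0 : ∀ k, dV' k ≠ 0)
variable (σ : {v : InfinitePlace (Fp L) // v.IsReal})
  {R S : Type} [Fintype R] [DecidableEq R] [Fintype S] [DecidableEq S]
  (eP : PosIdx (signVec (cmPlaceOver L) (fun k => Sum.elim (cmGramEntry L e' dV hdV (tensorFrame L dW eW dV') (tensorFrame_real L dW hdW eW dV' hdV')) (-cmGramEntry L e' dV hdV (tensorFrame L dW eW dV') (tensorFrame_real L dW hdW eW dV' hdV')) ((LocalSplitting.e₂ n').symm k)) (imagUnit L) σ) ≃ (Fin 2 × R) ⊕ (Fin 2 × S))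
  (eQ : NegIdx (signVec (cmPlaceOver L) (fun k => Sum.elim (cmGramEntry L e' dV hdV (tensorFrame L dW eW dV') (tensorFrame_real L dW hdW eW dV' hdV')) (-cmGramEntry L e' dV hdV (tensorFrame L dW eW dV') (tensorFrame_real L dW hdW eW dV' hdV')) ((LocalSplitting.e₂ n').symm k)) (imagUnit L) σ) ≃ (Fin 2 × S) ⊕ (Fin 2 × R))


-- the doubled metaplectic carrier of the big datum and the CM sign frame elaborate slowly (as ★ J2c: 4 000 000 heartbeats)
set_option maxHeartbeats 4000000

include hdW0 in
/-- **THE SAME WITH THE FOCK WITNESS UNIFORM IN THE POINT** (K2Liu-ref1 (g5) 13:34:55Z quantifier flag; the shape ★ FILE 2's (S-der) and FILE 3 consume): `F_Y` is chosen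
from `Y` and `F` ALONE (`F_Y := η′(0)•F + G`), BEFORE the point `H` and the vectors `a, a_Y`. [cite: KudlaRallis1994, §1] [cite: Folland1989, §4.2 (4.24), Prop. (4.39)] -/
theorem exists_fockPoly_hasDerivAt_swSectionTensor_oneplace_uniform {χ : HeckeCharacter L} (hχu : χ.IsUnitary) (hχs : IsSplittingChar L 1 χ)
    {sB : HA L e' dV hdV (tensorFrame L dW eW dV') (tensorFrame_real L dW hdW eW dV' hdV') →*
      MpD L e' dV hdV (tensorFrame L dW eW dV') (tensorFrame_real L dW hdW eW dV' hdV')}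
    (hsB : IsDoubledWeilRep L e' dV hdV hdV0 (tensorFrame L dW eW dV') (tensorFrame_real L dW hdW eW dV' hdV')
      (tensorFrame_ne_zero L dW eW dV' hdW0 hdV'0) χ sB)
    {t : InfinitePlace L → ℤ} (ht : χ.HasUnitaryArchType t 0) (hodd : ∀ w, Odd (t w))
    (f : FinSB (Fp L) (Fin (n' + n')))
    (ψ : UForm (Fin 2) (Fin 2) →* UnitaryGroup.arch (Fp L) L (IsCMField.complexConj L) (n + n) (hermD L e dV hdV dW hdW))
    (hsec : ∀ h : UForm (Fin 2) (Fin 2),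
      tensorEmb L e dV hdV dW hdW eW e' dV' hdV' (K2LiuArchOneParameterOrbitDefs.archEmb (Fp L) L (IsCMField.complexConj L) (n + n) (hermD L e dV hdV dW hdW) (ψ h)) =
        K2LiuArchOneParameterOrbitDefs.archEmb (Fp L) L (IsCMField.complexConj L) (n' + n') (hermD L e' dV hdV (tensorFrame L dW eW dV') (tensorFrame_real L dW hdW eW dV' hdV'))
          (placeSecJ L (IsCMField.complexConj L) (n' + n') (IsCMField.complexConj_ne_one L) (cmPlaceOver L) (cmPlaceOver_smul L) _
                (gramD_gram_realDiagonal_entry_ne_zero L e' dV hdV (tensorFrame L dW eW dV') (tensorFrame_real L dW hdW eW dV' hdV') hdV0 (tensorFrame_ne_zero L dW eW dV' hdW0 hdV'0)) (complexConj_imagUnit L) (imagUnit_ne_zero L) σ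
                (cmPlaceOver_comap L) (gramD_eq_diagonal_cm L e' dV hdV (tensorFrame L dW eW dV') (tensorFrame_real L dW hdW eW dV' hdV')) (J := hermD L e' dV hdV (tensorFrame L dW eW dV') (tensorFrame_real L dW hdW eW dV' hdV')) rfl
                (complexConj_smul_infinitePlace L) eP eQ ((toBig (Fin 2) (Fin 2) R S (h, 1), (1 : UForm Unit Empty)) : Ginf ((Fin 2 × R) ⊕ (Fin 2 × S)) ((Fin 2 × S) ⊕ (Fin 2 × R)) Unit Empty)))
    (Y : ↥(uFormGroup (Fin 2) (Fin 2)).lie.toSubmodule) (F : MvPolynomial (DPIdx (Fin 2) (Fin 2) R S) ℂ)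
    (Φ₂ : 𝓢(((Fin (n' + n') × {v : {v : InfinitePlace (Fp L) // v.IsReal} // v ≠ σ}) → ℝ), ℂ))
 :
    ∃ F_Y : MvPolynomial (DPIdx (Fin 2) (Fin 2) R S) ℂ, ∀ (H : HA L e dV hdV dW hdW) (a : 𝓢((Fin (n' + n') → mixedSpace (Fp L)), ℂ)),
      ((((schwartzTransport
                  (scaledFrame (Fp L) (Fin (n' + n'))
                    (placeScale (n' + n') fun v => sqrtAbs (signVec (cmPlaceOver L)
                      (fun k => Sum.elim (cmGramEntry L e' dV hdV (tensorFrame L dW eW dV') (tensorFrame_real L dW hdW eW dV' hdV')) (-cmGramEntry L e' dV hdV (tensorFrame L dW eW dV') (tensorFrame_real L dW hdW eW dV' hdV')) ((LocalSplitting.e₂ n').symm k))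
                      (imagUnit L) v))
                    (placeScale_ne_zero (n' + n') (sqrtAbs_signVec_ne_zero (IsCMField.complexConj_ne_one L) (cmPlaceOver_smul L)
                      (complexConj_imagUnit L) (imagUnit_ne_zero L) (gramD_gram_realDiagonal_entry_ne_zero L e' dV hdV (tensorFrame L dW eW dV') (tensorFrame_real L dW hdW eW dV' hdV') hdV0 (tensorFrame_ne_zero L dW eW dV' hdW0 hdV'0)))))).trans
                (schwartzTransport (reindexCLE (placeSplitEquiv (signSplit (signVec (cmPlaceOver L)
                  (fun k => Sum.elim (cmGramEntry L e' dV hdV (tensorFrame L dW eW dV') (tensorFrame_real L dW hdW eW dV' hdV')) (-cmGramEntry L e' dV hdV (tensorFrame L dW eW dV') (tensorFrame_real L dW hdW eW dV' hdV')) ((LocalSplitting.e₂ n').symm k))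
                  (imagUnit L) σ)) σ)))).trans
                (schwartzTransport (reindexCLE (Equiv.sumCongr
                  (unitJunctionIdx
                    (PosIdx (signVec (cmPlaceOver L)
                      (fun k => Sum.elim (cmGramEntry L e' dV hdV (tensorFrame L dW eW dV') (tensorFrame_real L dW hdW eW dV' hdV')) (-cmGramEntry L e' dV hdV (tensorFrame L dW eW dV') (tensorFrame_real L dW hdW eW dV' hdV')) ((LocalSplitting.e₂ n').symm k))
                      (imagUnit L) σ))
                    (NegIdx (signVec (cmPlaceOver L)
                      (fun k => Sum.elim (cmGramEntry L e' dV hdV (tensorFrame L dW eW dV') (tensorFrame_real L dW hdW eW dV' hdV')) (-cmGramEntry L e' dV hdV (tensorFrame L dW eW dV') (tensorFrame_real L dW hdW eW dV' hdV')) ((LocalSplitting.e₂ n').symm k))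
                      (imagUnit L) σ))).symm
                  (Equiv.refl (Fin (n' + n') × {v : {v : InfinitePlace (Fp L) // v.IsReal} // v ≠ σ})))))).trans
                (schwartzTransport (reindexCLE (Equiv.sumCongr
                  (dpIdxCongr
                    (PosIdx (signVec (cmPlaceOver L)
                      (fun k => Sum.elim (cmGramEntry L e' dV hdV (tensorFrame L dW eW dV') (tensorFrame_real L dW hdW eW dV' hdV')) (-cmGramEntry L e' dV hdV (tensorFrame L dW eW dV') (tensorFrame_real L dW hdW eW dV' hdV')) ((LocalSplitting.e₂ n').symm k))
                      (imagUnit L) σ))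
                    (NegIdx (signVec (cmPlaceOver L)
                      (fun k => Sum.elim (cmGramEntry L e' dV hdV (tensorFrame L dW eW dV') (tensorFrame_real L dW hdW eW dV' hdV')) (-cmGramEntry L e' dV hdV (tensorFrame L dW eW dV') (tensorFrame_real L dW hdW eW dV' hdV')) ((LocalSplitting.e₂ n').symm k))
                      (imagUnit L) σ))
                    Unit Empty ((Fin 2 × R) ⊕ (Fin 2 × S)) ((Fin 2 × S) ⊕ (Fin 2 × R)) Unit Empty eP eQ (Equiv.refl Unit) (Equiv.refl Empty)).symm
                  (Equiv.refl (Fin (n' + n') × {v : {v : InfinitePlace (Fp L) // v.IsReal} // v ≠ σ})))))) a = tensorPi ((schwartzTransport (reindexCLE (unitJunctionIdx ((Fin 2 × R) ⊕ (Fin 2 × S)) ((Fin 2 × S) ⊕ (Fin 2 × R))).symm)) (binvPi F)) Φ₂ →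
      ∀ a_Y : 𝓢((Fin (n' + n') → mixedSpace (Fp L)), ℂ),
      ((((schwartzTransport
                  (scaledFrame (Fp L) (Fin (n' + n'))
                    (placeScale (n' + n') fun v => sqrtAbs (signVec (cmPlaceOver L)
                      (fun k => Sum.elim (cmGramEntry L e' dV hdV (tensorFrame L dW eW dV') (tensorFrame_real L dW hdW eW dV' hdV')) (-cmGramEntry L e' dV hdV (tensorFrame L dW eW dV') (tensorFrame_real L dW hdW eW dV' hdV')) ((LocalSplitting.e₂ n').symm k))
                      (imagUnit L) v))
                    (placeScale_ne_zero (n' + n') (sqrtAbs_signVec_ne_zero (IsCMField.complexConj_ne_one L) (cmPlaceOver_smul L)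
                      (complexConj_imagUnit L) (imagUnit_ne_zero L) (gramD_gram_realDiagonal_entry_ne_zero L e' dV hdV (tensorFrame L dW eW dV') (tensorFrame_real L dW hdW eW dV' hdV') hdV0 (tensorFrame_ne_zero L dW eW dV' hdW0 hdV'0)))))).trans
                (schwartzTransport (reindexCLE (placeSplitEquiv (signSplit (signVec (cmPlaceOver L)
                  (fun k => Sum.elim (cmGramEntry L e' dV hdV (tensorFrame L dW eW dV') (tensorFrame_real L dW hdW eW dV' hdV')) (-cmGramEntry L e' dV hdV (tensorFrame L dW eW dV') (tensorFrame_real L dW hdW eW dV' hdV')) ((LocalSplitting.e₂ n').symm k))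
                  (imagUnit L) σ)) σ)))).trans
                (schwartzTransport (reindexCLE (Equiv.sumCongr
                  (unitJunctionIdx
                    (PosIdx (signVec (cmPlaceOver L)
                      (fun k => Sum.elim (cmGramEntry L e' dV hdV (tensorFrame L dW eW dV') (tensorFrame_real L dW hdW eW dV' hdV')) (-cmGramEntry L e' dV hdV (tensorFrame L dW eW dV') (tensorFrame_real L dW hdW eW dV' hdV')) ((LocalSplitting.e₂ n').symm k))
                      (imagUnit L) σ))
                    (NegIdx (signVec (cmPlaceOver L)
                      (fun k => Sum.elim (cmGramEntry L e' dV hdV (tensorFrame L dW eW dV') (tensorFrame_real L dW hdW eW dV' hdV')) (-cmGramEntry L e' dV hdV (tensorFrame L dW eW dV') (tensorFrame_real L dW hdW eW dV' hdV')) ((LocalSplitting.e₂ n').symm k))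
                      (imagUnit L) σ))).symm
                  (Equiv.refl (Fin (n' + n') × {v : {v : InfinitePlace (Fp L) // v.IsReal} // v ≠ σ})))))).trans
                (schwartzTransport (reindexCLE (Equiv.sumCongr
                  (dpIdxCongr
                    (PosIdx (signVec (cmPlaceOver L)
                      (fun k => Sum.elim (cmGramEntry L e' dV hdV (tensorFrame L dW eW dV') (tensorFrame_real L dW hdW eW dV' hdV')) (-cmGramEntry L e' dV hdV (tensorFrame L dW eW dV') (tensorFrame_real L dW hdW eW dV' hdV')) ((LocalSplitting.e₂ n').symm k))
                      (imagUnit L) σ))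
                    (NegIdx (signVec (cmPlaceOver L)
                      (fun k => Sum.elim (cmGramEntry L e' dV hdV (tensorFrame L dW eW dV') (tensorFrame_real L dW hdW eW dV' hdV')) (-cmGramEntry L e' dV hdV (tensorFrame L dW eW dV') (tensorFrame_real L dW hdW eW dV' hdV')) ((LocalSplitting.e₂ n').symm k))
                      (imagUnit L) σ))
                    Unit Empty ((Fin 2 × R) ⊕ (Fin 2 × S)) ((Fin 2 × S) ⊕ (Fin 2 × R)) Unit Empty eP eQ (Equiv.refl Unit) (Equiv.refl Empty)).symm
                  (Equiv.refl (Fin (n' + n') × {v : {v : InfinitePlace (Fp L) // v.IsReal} // v ≠ σ})))))) a_Y = tensorPi ((schwartzTransport (reindexCLE (unitJunctionIdx ((Fin 2 × R) ⊕ (Fin 2 × S)) ((Fin 2 × S) ⊕ (Fin 2 × R))).symm)) (binvPi F_Y)) Φ₂ →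
      HasDerivAt (fun s : ℝ => swSectionTensor L e dV hdV dW hdW eW e' dV' hdV' hdV0 hdW0 hdV'0 sB (piSchwartzBruhatEquiv (Fp L) (Fin (n' + n')) (a ⊗ₜ f))
          (H * K2LiuArchOneParameterOrbitDefs.archEmb (Fp L) L (IsCMField.complexConj L) (n + n) (hermD L e dV hdV dW hdW) (ψ ((uFormGroup (Fin 2) (Fin 2)).expMem ⟨((s • Y : ↥(uFormGroup (Fin 2) (Fin 2)).lie.toSubmodule) : Matrix (Fin 2 ⊕ Fin 2) (Fin 2 ⊕ Fin 2) ℂ), (s • Y).2⟩ : UForm (Fin 2) (Fin 2)))))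
        (swSectionTensor L e dV hdV dW hdW eW e' dV' hdV' hdV0 hdW0 hdV'0 sB (piSchwartzBruhatEquiv (Fp L) (Fin (n' + n')) (a_Y ⊗ₜ f)) H) 0 := by
  -- the polynomial × Gaussian stability of the derivative vector (★ S2-W part 1)
  obtain ⟨G, hG⟩ := exists_dOmega_binvPi (R := R) (S := S)
    (⟨-(Fintype.card S : ℤ), -(Fintype.card R : ℤ), -(Fintype.card (Fin 2) : ℤ), -(Fintype.card (Fin 2) : ℤ)⟩ : VacExponents)
    (fun i => (u22AdaptedBasis.repr Y) i) F
  refine ⟨(deriv (fun s : ℝ => (((etaD L e' dV hdV (tensorFrame L dW eW dV') (tensorFrame_real L dW hdW eW dV' hdV') t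
              (placeSecJ L (IsCMField.complexConj L) (n' + n') (IsCMField.complexConj_ne_one L) (cmPlaceOver L) (cmPlaceOver_smul L) _
                (gramD_gram_realDiagonal_entry_ne_zero L e' dV hdV (tensorFrame L dW eW dV') (tensorFrame_real L dW hdW eW dV' hdV') hdV0 (tensorFrame_ne_zero L dW eW dV' hdW0 hdV'0)) (complexConj_imagUnit L) (imagUnit_ne_zero L) σ
                (cmPlaceOver_comap L) (gramD_eq_diagonal_cm L e' dV hdV (tensorFrame L dW eW dV') (tensorFrame_real L dW hdW eW dV' hdV')) (J := hermD L e' dV hdV (tensorFrame L dW eW dV') (tensorFrame_real L dW hdW eW dV' hdV')) rfl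
                (complexConj_smul_infinitePlace L) eP eQ ((toBig (Fin 2) (Fin 2) R S (((uFormGroup (Fin 2) (Fin 2)).expMem ⟨((s • Y : ↥(uFormGroup (Fin 2) (Fin 2)).lie.toSubmodule) : Matrix (Fin 2 ⊕ Fin 2) (Fin 2 ⊕ Fin 2) ℂ), (s • Y).2⟩ : UForm (Fin 2) (Fin 2)), 1), (1 : UForm Unit Empty)) : Ginf ((Fin 2 × R) ⊕ (Fin 2 × S)) ((Fin 2 × S) ⊕ (Fin 2 × R)) Unit Empty)) : ℂˣ) : ℂ))) 0) • F + G, fun H a ha a_Y ha_Y => ?_⟩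
  obtain ⟨ℓ', hℓ'⟩ := exists_clm_swSectionTensor_mul_oneplace_eq L e dV hdV hdV0 dW hdW hdW0 eW e' dV' hdV' hdV'0 σ eP eQ hχu hχs hsB ht hodd H f ψ hsec
  -- the curve `k(s) = exp (sY)`, `k(0) = 1`
  have hk0 : ((((uFormGroup (Fin 2) (Fin 2)).expMem ⟨(((0 : ℝ) • Y : ↥(uFormGroup (Fin 2) (Fin 2)).lie.toSubmodule) : Matrix (Fin 2 ⊕ Fin 2) (Fin 2 ⊕ Fin 2) ℂ), ((0 : ℝ) • Y).2⟩ : UForm (Fin 2) (Fin 2)), (1 : UForm R S)) : Ginf (Fin 2) (Fin 2) R S) = 1 := by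
    rw [expMem_zero_smul]; rfl
  -- (1) the character leg `η(s) = η_t(placeSecJ_𝕎 σ (toBig (k s, 1), 1))`: smooth (É. Cartan at the continuous character), `η(0) = 1`
  have hηc : Continuous fun u : Ginf (Fin 2) (Fin 2) R S => ((etaD L e' dV hdV (tensorFrame L dW eW dV') (tensorFrame_real L dW hdW eW dV' hdV') t
      (placeSecJ L (IsCMField.complexConj L) (n' + n') (IsCMField.complexConj_ne_one L) (cmPlaceOver L) (cmPlaceOver_smul L) _
                (gramD_gram_realDiagonal_entry_ne_zero L e' dV hdV (tensorFrame L dW eW dV') (tensorFrame_real L dW hdW eW dV' hdV') hdV0 (tensorFrame_ne_zero L dW eW dV' hdW0 hdV'0)) (complexConj_imagUnit L) (imagUnit_ne_zero L) σ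
                (cmPlaceOver_comap L) (gramD_eq_diagonal_cm L e' dV hdV (tensorFrame L dW eW dV') (tensorFrame_real L dW hdW eW dV' hdV')) (J := hermD L e' dV hdV (tensorFrame L dW eW dV') (tensorFrame_real L dW hdW eW dV' hdV')) rfl
                (complexConj_smul_infinitePlace L) eP eQ ((toBig (Fin 2) (Fin 2) R S u, (1 : UForm Unit Empty)) : Ginf ((Fin 2 × R) ⊕ (Fin 2 × S)) ((Fin 2 × S) ⊕ (Fin 2 × R)) Unit Empty)) : ℂˣ) : ℂ) :=
    (continuous_coe_etaD_placeSecJ L e' dV hdV hdV0 (tensorFrame L dW eW dV') (tensorFrame_real L dW hdW eW dV' hdV') (tensorFrame_ne_zero L dW eW dV' hdW0 hdV'0)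
      σ eP eQ t).comp (continuous_toBig.prodMk continuous_const)
  have hηs : ContDiffAt ℝ ((⊤ : ℕ∞) : WithTop ℕ∞) (fun s : ℝ => (((etaD L e' dV hdV (tensorFrame L dW eW dV') (tensorFrame_real L dW hdW eW dV' hdV') t
              (placeSecJ L (IsCMField.complexConj L) (n' + n') (IsCMField.complexConj_ne_one L) (cmPlaceOver L) (cmPlaceOver_smul L) _
                (gramD_gram_realDiagonal_entry_ne_zero L e' dV hdV (tensorFrame L dW eW dV') (tensorFrame_real L dW hdW eW dV' hdV') hdV0 (tensorFrame_ne_zero L dW eW dV' hdW0 hdV'0)) (complexConj_imagUnit L) (imagUnit_ne_zero L) σ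
                (cmPlaceOver_comap L) (gramD_eq_diagonal_cm L e' dV hdV (tensorFrame L dW eW dV') (tensorFrame_real L dW hdW eW dV' hdV')) (J := hermD L e' dV hdV (tensorFrame L dW eW dV') (tensorFrame_real L dW hdW eW dV' hdV')) rfl
                (complexConj_smul_infinitePlace L) eP eQ ((toBig (Fin 2) (Fin 2) R S (((uFormGroup (Fin 2) (Fin 2)).expMem ⟨((s • Y : ↥(uFormGroup (Fin 2) (Fin 2)).lie.toSubmodule) : Matrix (Fin 2 ⊕ Fin 2) (Fin 2 ⊕ Fin 2) ℂ), (s • Y).2⟩ : UForm (Fin 2) (Fin 2)), 1), (1 : UForm Unit Empty)) : Ginf ((Fin 2 × R) ⊕ (Fin 2 × S)) ((Fin 2 × S) ⊕ (Fin 2 × R)) Unit Empty)) : ℂˣ) : ℂ))) 0 :=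
    contDiffAt_character_inl
      (χ := (Units.coeHom ℂ).comp ((etaD L e' dV hdV (tensorFrame L dW eW dV') (tensorFrame_real L dW hdW eW dV' hdV') t).comp
        ((placeSecJ L (IsCMField.complexConj L) (n' + n') (IsCMField.complexConj_ne_one L) (cmPlaceOver L) (cmPlaceOver_smul L) _
                (gramD_gram_realDiagonal_entry_ne_zero L e' dV hdV (tensorFrame L dW eW dV') (tensorFrame_real L dW hdW eW dV' hdV') hdV0 (tensorFrame_ne_zero L dW eW dV' hdW0 hdV'0)) (complexConj_imagUnit L) (imagUnit_ne_zero L) σ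
                (cmPlaceOver_comap L) (gramD_eq_diagonal_cm L e' dV hdV (tensorFrame L dW eW dV') (tensorFrame_real L dW hdW eW dV' hdV')) (J := hermD L e' dV hdV (tensorFrame L dW eW dV') (tensorFrame_real L dW hdW eW dV' hdV')) rfl
                (complexConj_smul_infinitePlace L) eP eQ).comp
          ((MonoidHom.inl (UForm ((Fin 2 × R) ⊕ (Fin 2 × S)) ((Fin 2 × S) ⊕ (Fin 2 × R))) (UForm Unit Empty)).comp (toBig (Fin 2) (Fin 2) R S)))))
      hηc (contDiffAt_coe_expMem_smul Y 0)
  have hη := (hηs.differentiableAt (by simp)).hasDerivAt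
  have hη0 : (((etaD L e' dV hdV (tensorFrame L dW eW dV') (tensorFrame_real L dW hdW eW dV' hdV') t
              (placeSecJ L (IsCMField.complexConj L) (n' + n') (IsCMField.complexConj_ne_one L) (cmPlaceOver L) (cmPlaceOver_smul L) _
                (gramD_gram_realDiagonal_entry_ne_zero L e' dV hdV (tensorFrame L dW eW dV') (tensorFrame_real L dW hdW eW dV' hdV') hdV0 (tensorFrame_ne_zero L dW eW dV' hdW0 hdV'0)) (complexConj_imagUnit L) (imagUnit_ne_zero L) σ
                (cmPlaceOver_comap L) (gramD_eq_diagonal_cm L e' dV hdV (tensorFrame L dW eW dV') (tensorFrame_real L dW hdW eW dV' hdV')) (J := hermD L e' dV hdV (tensorFrame L dW eW dV') (tensorFrame_real L dW hdW eW dV' hdV')) rfl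
                (complexConj_smul_infinitePlace L) eP eQ ((toBig (Fin 2) (Fin 2) R S (((uFormGroup (Fin 2) (Fin 2)).expMem ⟨(((0 : ℝ) • Y : ↥(uFormGroup (Fin 2) (Fin 2)).lie.toSubmodule) : Matrix (Fin 2 ⊕ Fin 2) (Fin 2 ⊕ Fin 2) ℂ), ((0 : ℝ) • Y).2⟩ : UForm (Fin 2) (Fin 2)), 1), (1 : UForm Unit Empty)) : Ginf ((Fin 2 × R) ⊕ (Fin 2 × S)) ((Fin 2 × S) ⊕ (Fin 2 × R)) Unit Empty)) : ℂˣ) : ℂ)) = 1 := by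
    rw [hk0, map_one]
    simp only [Prod.mk_one_one, map_one, Units.val_one]
  -- (2) the Weil leg through `T′ := ℓ′ ∘ (· ⊠ Φ₂) ∘ e_*` on the junction datum `weilRepPair` of `U(2,2) × U(R,S)`
  have hω := hasDerivAt_weilDatum_expMem_smul' (isArchWeilDatum_weilRepPair (Fin 2) (Fin 2) R S) weilRepPair_κ_hermitePi_zero
    ((ℓ'.comp ((SchwartzMap.sumProdLeftCLM (𝕜 := ℂ) (E := ℝ) (ι₁ := DPIdx ((Fin 2 × R) ⊕ (Fin 2 × S)) ((Fin 2 × S) ⊕ (Fin 2 × R)) Unit Empty) Φ₂).comp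
      ((schwartzTransport (reindexCLE (unitJunctionIdx ((Fin 2 × R) ⊕ (Fin 2 × S)) ((Fin 2 × S) ⊕ (Fin 2 × R))).symm)) : 𝓢((DPIdx (Fin 2) (Fin 2) R S → ℝ), ℂ) →L[ℂ] 𝓢((DPIdx ((Fin 2 × R) ⊕ (Fin 2 × S)) ((Fin 2 × S) ⊕ (Fin 2 × R)) Unit Empty → ℝ), ℂ)))).restrictScalars ℝ) (binvPi F) Y
  have hω0 : ((weilRep (α := (Fin 2 × R) ⊕ (Fin 2 × S)) (β := (Fin 2 × S) ⊕ (Fin 2 × R))).comp (toBig (Fin 2) (Fin 2) R S)) ((((uFormGroup (Fin 2) (Fin 2)).expMem ⟨(((0 : ℝ) • Y : ↥(uFormGroup (Fin 2) (Fin 2)).lie.toSubmodule) : Matrix (Fin 2 ⊕ Fin 2) (Fin 2 ⊕ Fin 2) ℂ), ((0 : ℝ) • Y).2⟩ : UForm (Fin 2) (Fin 2)), (1 : UForm R S)) : Ginf (Fin 2) (Fin 2) R S) (binvPi F) = binvPi F := by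
    rw [hk0, map_one, Module.End.one_apply]
  -- (3) along the curve the section IS `η(s) · T′(ω(k s, 1) B⁻¹F)` (★ J2c)
  have hfun : (fun s : ℝ => swSectionTensor L e dV hdV dW hdW eW e' dV' hdV' hdV0 hdW0 hdV'0 sB (piSchwartzBruhatEquiv (Fp L) (Fin (n' + n')) (a ⊗ₜ f))
          (H * K2LiuArchOneParameterOrbitDefs.archEmb (Fp L) L (IsCMField.complexConj L) (n + n) (hermD L e dV hdV dW hdW) (ψ ((uFormGroup (Fin 2) (Fin 2)).expMem ⟨((s • Y : ↥(uFormGroup (Fin 2) (Fin 2)).lie.toSubmodule) : Matrix (Fin 2 ⊕ Fin 2) (Fin 2 ⊕ Fin 2) ℂ), (s • Y).2⟩ : UForm (Fin 2) (Fin 2))))) =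
      fun s : ℝ => (((etaD L e' dV hdV (tensorFrame L dW eW dV') (tensorFrame_real L dW hdW eW dV' hdV') t
              (placeSecJ L (IsCMField.complexConj L) (n' + n') (IsCMField.complexConj_ne_one L) (cmPlaceOver L) (cmPlaceOver_smul L) _
                (gramD_gram_realDiagonal_entry_ne_zero L e' dV hdV (tensorFrame L dW eW dV') (tensorFrame_real L dW hdW eW dV' hdV') hdV0 (tensorFrame_ne_zero L dW eW dV' hdW0 hdV'0)) (complexConj_imagUnit L) (imagUnit_ne_zero L) σ
                (cmPlaceOver_comap L) (gramD_eq_diagonal_cm L e' dV hdV (tensorFrame L dW eW dV') (tensorFrame_real L dW hdW eW dV' hdV')) (J := hermD L e' dV hdV (tensorFrame L dW eW dV') (tensorFrame_real L dW hdW eW dV' hdV')) rfl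
                (complexConj_smul_infinitePlace L) eP eQ ((toBig (Fin 2) (Fin 2) R S (((uFormGroup (Fin 2) (Fin 2)).expMem ⟨((s • Y : ↥(uFormGroup (Fin 2) (Fin 2)).lie.toSubmodule) : Matrix (Fin 2 ⊕ Fin 2) (Fin 2 ⊕ Fin 2) ℂ), (s • Y).2⟩ : UForm (Fin 2) (Fin 2)), 1), (1 : UForm Unit Empty)) : Ginf ((Fin 2 × R) ⊕ (Fin 2 × S)) ((Fin 2 × S) ⊕ (Fin 2 × R)) Unit Empty)) : ℂˣ) : ℂ)) *
        ((ℓ'.comp ((SchwartzMap.sumProdLeftCLM (𝕜 := ℂ) (E := ℝ) (ι₁ := DPIdx ((Fin 2 × R) ⊕ (Fin 2 × S)) ((Fin 2 × S) ⊕ (Fin 2 × R)) Unit Empty) Φ₂).comp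
          ((schwartzTransport (reindexCLE (unitJunctionIdx ((Fin 2 × R) ⊕ (Fin 2 × S)) ((Fin 2 × S) ⊕ (Fin 2 × R))).symm)) : 𝓢((DPIdx (Fin 2) (Fin 2) R S → ℝ), ℂ) →L[ℂ] 𝓢((DPIdx ((Fin 2 × R) ⊕ (Fin 2 × S)) ((Fin 2 × S) ⊕ (Fin 2 × R)) Unit Empty → ℝ), ℂ)))).restrictScalars ℝ)
          (((weilRep (α := (Fin 2 × R) ⊕ (Fin 2 × S)) (β := (Fin 2 × S) ⊕ (Fin 2 × R))).comp (toBig (Fin 2) (Fin 2) R S)) ((((uFormGroup (Fin 2) (Fin 2)).expMem ⟨((s • Y : ↥(uFormGroup (Fin 2) (Fin 2)).lie.toSubmodule) : Matrix (Fin 2 ⊕ Fin 2) (Fin 2 ⊕ Fin 2) ℂ), (s • Y).2⟩ : UForm (Fin 2) (Fin 2)), (1 : UForm R S)) : Ginf (Fin 2) (Fin 2) R S) (binvPi F)) := by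
    funext s
    rw [hℓ' _ (binvPi F) Φ₂ a ha, ContinuousLinearMap.coe_restrictScalars', ContinuousLinearMap.comp_apply, ContinuousLinearMap.comp_apply,
      ContinuousLinearEquiv.coe_coe, sumProdLeftCLM_apply_eq_tensorPi]
  -- (4) the Fock polynomial of the derivative and the product rule
  rw [hfun]
  have hprod := hη.mul hω
  rw [hη0, hω0, one_mul] at hprod
  refine hprod.congr_deriv ?_
  -- the value read back through ★ J2c at `h = 1`
  have h1 := hℓ' 1 (binvPi ((deriv (fun s : ℝ => (((etaD L e' dV hdV (tensorFrame L dW eW dV') (tensorFrame_real L dW hdW eW dV' hdV') t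
              (placeSecJ L (IsCMField.complexConj L) (n' + n') (IsCMField.complexConj_ne_one L) (cmPlaceOver L) (cmPlaceOver_smul L) _
                (gramD_gram_realDiagonal_entry_ne_zero L e' dV hdV (tensorFrame L dW eW dV') (tensorFrame_real L dW hdW eW dV' hdV') hdV0 (tensorFrame_ne_zero L dW eW dV' hdW0 hdV'0)) (complexConj_imagUnit L) (imagUnit_ne_zero L) σ
                (cmPlaceOver_comap L) (gramD_eq_diagonal_cm L e' dV hdV (tensorFrame L dW eW dV') (tensorFrame_real L dW hdW eW dV' hdV')) (J := hermD L e' dV hdV (tensorFrame L dW eW dV') (tensorFrame_real L dW hdW eW dV' hdV')) rfl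
                (complexConj_smul_infinitePlace L) eP eQ ((toBig (Fin 2) (Fin 2) R S (((uFormGroup (Fin 2) (Fin 2)).expMem ⟨((s • Y : ↥(uFormGroup (Fin 2) (Fin 2)).lie.toSubmodule) : Matrix (Fin 2 ⊕ Fin 2) (Fin 2 ⊕ Fin 2) ℂ), (s • Y).2⟩ : UForm (Fin 2) (Fin 2)), 1), (1 : UForm Unit Empty)) : Ginf ((Fin 2 × R) ⊕ (Fin 2 × S)) ((Fin 2 × S) ⊕ (Fin 2 × R)) Unit Empty)) : ℂˣ) : ℂ))) 0) • F + G)) Φ₂ a_Y ha_Y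
  simp only [map_one, mul_one, Prod.mk_one_one, Units.val_one, one_mul, Module.End.one_apply] at h1
  rw [h1, binvPi_add, binvPi_smul, ← hG]
  simp only [ContinuousLinearMap.coe_restrictScalars', ContinuousLinearMap.comp_apply, ContinuousLinearEquiv.coe_coe, sumProdLeftCLM_apply_eq_tensorPi,
    map_add, map_smul, tensorPi_add_left, tensorPi_smul_left, smul_eq_mul]



end Summit.HodgeConjecture.HodgeConjecture.Cruxes.HLiu418.K2LiuArchSWValueFockDerivativeUniform

end
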